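import Mathlib
import Summits.Langlands.Langlands.Theses.ParityBlindBianchi

/-!
# Sketch (crux-ideate, ideator 2, round 1): `TwoAdicBianchiProModularityLevel` — the Bianchi
purity fern

First lemmas of the line `bianchi-purity-fern` for the crux
`Summit.Langlands.Langlands.Theses.ParityBlindBianchi.TwoAdicBianchiProModularityLevel`
(stmt-Langlands-15110).  Pure commutative algebra / order theory over Mathlib; both PROVED.

* `sign_eq_one_or_neg_one` — THE SIGN LEMMA behind the new obstruction-side fact: in a
  commutative ring in which `2` is a unit and which has no non-trivial idempotents (= `Spec`
  connected), every element of square `1` is `±1`.  Applied to `R = 𝒪(Ω)` for a connected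
  component `Ω` of `Spec R_{K,S}(σ̄)[1/2]` and to `s_w := det ρ^univ(art_w(−1))` (`w ∈ S`), it says the
  local signs `s_w` are constant on `Ω`; since twisting by `ψ` multiplies `s_w` by `ψ(art_w(−1))² = 1`,
  they are twist invariants, and the `ℚ`-product formula then forces any odd base-change seed on the
  component of the even point `σ = ρ|_K` to carry its sign defect at a prime of `S₀` RAMIFIED in `K`
  and `≡ 3 (mod 4)` (NOTES.md §KEY OBSTRUCTION-SIDE FINDING).
* `PrimeSpectrum.eq_of_le_of_coheight_le` — THE FERN ENDGAME: if `𝔮 ≤ 𝔮'` are primes and the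
  irreducible closed set `V(𝔮')` has dimension (= coheight) at least that of `V(𝔮)`, finite, then
  `𝔮 = 𝔮'`.  Used with `𝔮` = the generic point of the irreducible component `Ω_σ` of
  `Spec R_{K,S}(σ̄)[1/2]` and `𝔮'` = the generic point of the irreducible closed subset `T ⊇ P₀` of
  `Spec 𝕋_K(U^p)_𝔪[1/2]` produced by the fern (`dim T ≥ 5 = dim Ω_σ`): `T = Ω_σ ⊂ Spec 𝕋`, so the
  Artin point `σ ∈ Ω_σ` is a point of the big Hecke algebra.
-/

namespace Summit.Langlands.Langlands.Cruxes.TwoAdicBianchiProModularityLevel.BianchiPurityFern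

/-- The crux this sketch serves, by name (elaboration check only). -/
example : Prop :=
  Summit.Langlands.Langlands.Theses.ParityBlindBianchi.TwoAdicBianchiProModularityLevel

/-- SIGN LEMMA.  In a commutative ring in which `2` is a unit and whose only idempotents are `0`
and `1` (i.e. `Spec R` is connected), an element of square one is `1` or `-1`.
Galois meaning: `s = det ρ^univ(art_w(-1))` on a connected component of the generic fibre of a
2-adic deformation ring. -/
theorem sign_eq_one_or_neg_one {R : Type*} [CommRing R] (h2 : IsUnit (2 : R))
    (hconn : ∀ e : R, IsIdempotentElem e → e = 0 ∨ e = 1) {s : R} (hs : s * s = 1) :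
    s = 1 ∨ s = -1 := by
  obtain ⟨u, hu⟩ := h2.exists_left_inv
  -- `e := u * (1 + s)` is idempotent: `e² = u² (1 + 2s + s²) = u² · 2 · (1 + s) = u (1 + s)`.
  have he : IsIdempotentElem (u * (1 + s)) := by
    change u * (1 + s) * (u * (1 + s)) = u * (1 + s)
    have h1 : (1 + s) * (1 + s) = 2 * (1 + s) := by linear_combination hs
    calc u * (1 + s) * (u * (1 + s)) = u * (u * ((1 + s) * (1 + s))) := by ring
      _ = u * (u * (2 * (1 + s))) := by rw [h1]
      _ = u * ((u * 2) * (1 + s)) := by ring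
      _ = u * (1 + s) := by rw [hu, one_mul]
  rcases hconn _ he with h0 | h1
  · -- `u (1 + s) = 0` ⇒ `1 + s = 2 u (1 + s) = 0`
    right
    have : (1 + s) = 2 * (u * (1 + s)) := by
      calc (1 + s) = (u * 2) * (1 + s) := by rw [hu, one_mul]
        _ = 2 * (u * (1 + s)) := by ring
    rw [h0, mul_zero] at this
    linear_combination this
  · -- `u (1 + s) = 1` ⇒ `1 + s = 2`
    left
    have : (1 + s) = 2 * (u * (1 + s)) := by
      calc (1 + s) = (u * 2) * (1 + s) := by rw [hu, one_mul]
        _ = 2 * (u * (1 + s)) := by ring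
    rw [h1, mul_one] at this
    linear_combination this

/-- Twist invariance of the signs, abstractly: multiplying an element of square one by the square
of another element of square one does not change it. (`s_w(ρ ⊗ ψ) = s_w(ρ) · ψ(art_w(-1))²`.) -/
theorem sign_mul_sq_eq {R : Type*} [CommRing R] {s t : R} (ht : t * t = 1) :
    s * (t * t) = s := by
  rw [ht, mul_one]

/-- FERN ENDGAME (order-theoretic core).  If `p ≤ q` in a partial order, the coheight of `q` is
finite and at least the coheight of `p`, then `p = q`.  For `PrimeSpectrum R` (ordered by
inclusion) the coheight of `𝔭` is `dim R ⧸ 𝔭`, the dimension of the irreducible closed set `V(𝔭)`. -/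
theorem eq_of_le_of_coheight_le {α : Type*} [PartialOrder α] {p q : α} (hle : p ≤ q)
    (hfin : Order.coheight q < ⊤) (hdim : Order.coheight p ≤ Order.coheight q) : p = q := by
  rcases hle.lt_or_eq with hlt | heq
  · exact absurd hdim (not_le.mpr (Order.coheight_strictAnti hlt hfin))
  · exact heq

/-- The same, stated for prime ideals of a commutative ring: an irreducible closed subset
`V(𝔮') ⊆ V(𝔮)` of `Spec R` whose dimension is finite and at least `dim V(𝔮)` IS `V(𝔮)`.  In the
fern: `V(𝔮) = Ω_σ` (irreducible component of the deformation space through the Artin point),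
`V(𝔮') = T` (the irreducible closed subset of `Spec 𝕋` swept out by the base-change plane and the
purity needles). -/
theorem _root_.PrimeSpectrum.eq_of_le_of_coheight_le {R : Type*} [CommRing R]
    {p q : PrimeSpectrum R} (hle : p ≤ q) (hfin : Order.coheight q < ⊤)
    (hdim : Order.coheight p ≤ Order.coheight q) : p = q :=
  Summit.Langlands.Langlands.Cruxes.TwoAdicBianchiProModularityLevel.BianchiPurityFern.eq_of_le_of_coheight_le
    hle hfin hdim

end Summit.Langlands.Langlands.Cruxes.TwoAdicBianchiProModularityLevel.BianchiPurityFern
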